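import Mathlib.Combinatorics.SimpleGraph.Clique
import Mathlib.Combinatorics.SimpleGraph.Maps
import Mathlib.Combinatorics.SimpleGraph.Finite
import Mathlib.Data.Nat.Choose.Sum
import Mathlib.Data.Fintype.BigOperators
import Mathlib.Algebra.BigOperators.Ring.Finset
import Literature.ModelTheory.FiniteModelTheory.CkEquivHomCount
import HarnessLib

/-!
# Route PhaseTwins, support `DensityContinuityBelow` (stmt-PneNP-2725): homomorphism counts of small graphs determine the numbers of independent sets of each small size

The combinatorial half of the proof of `Summit.PneNP.PneNP.Theses.PhaseTwins.DensityContinuityBelow`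
(and the "inj/ind ↔ hom inversion lemma" wanted on its sibling `LogDepthContinuityBelow`): if two
finite simple graphs `G`, `H` on the same vertex set have `|Hom(F, G)| = |Hom(F, H)|` for every graph
`F` on `Fin s`, `s ≤ m`, then for every `j ≤ m` they have the same number of independent sets of
size `j` (`natCard_indepSets_eq_of_homCount_eq`), i.e. the independence polynomials `Z_G`, `Z_H`
agree in degrees `≤ m`.

Proof (Lovász-style inclusion–exclusion, kept elementary).
* `natCard_indepMaps_eq_sum`: the number `b_s(G)` of maps `f : Fin s → V(G)` whose image spans no
  edge equals `∑_{A ⊆ E(K_s)} (-1)^{|A|} |Hom((Fin s, A), G)|` — swap the sums and use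
  `∑_{A ⊆ E_f} (-1)^{|A|} = [E_f = ∅]` for the set `E_f` of pairs mapped to edges
  (`Finset.sum_powerset_neg_one_pow_card`). Hence equal hom counts give `b_s(G) = b_s(H)`.
* `natCard_indepMaps_eq_sum_surj`: sorting such maps by their image,
  `b_s(G) = ∑_j surj(s, j) · i_j(G)` with `i_j(G)` the number of independent `j`-sets and
  `surj(s, j)` the number of surjections `Fin s → Fin j` (`surj(s, j) = 0` for `j > s`,
  `surj(s, s) ≠ 0`), a triangular system: induction on `j` (`natCard_indepSets_eq_of_natCard_indepMaps_eq`).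

Everything is stated with `Nat.card` of subtypes (no decidability instances in statements) and for
an arbitrary finite vertex type `V`. No named facts are used.
-/

namespace Summit.PneNP.PneNP.Theorems.DensityContinuityBelow

-- `Summit.PneNP.PneNP` is the harness layout (summit = problem), not an accidental duplication.
set_option linter.dupNamespace false

open Finset SimpleGraph
open Literature.ModelTheory.FiniteModelTheory

variable {V : Type*} [Fintype V] [DecidableEq V]

omit [Fintype V] in
/-- A map `f : Fin s → V` sends no pair to an edge of `G` iff its image is an independent set of
`G` (loops do not exist, so coincidences `f i = f j` are harmless). -/
theorem forall_not_adj_iff_isIndepSet_image (G : SimpleGraph V) {s : ℕ} (f : Fin s → V) :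
    (∀ i j, ¬ G.Adj (f i) (f j)) ↔ G.IsIndepSet ↑(univ.image f) := by
  constructor
  · intro h x hx y hy _
    rw [coe_image, Set.mem_image] at hx hy
    obtain ⟨i, -, rfl⟩ := hx
    obtain ⟨j, -, rfl⟩ := hy
    exact h i j
  · intro h i j hadj
    have hi : f i ∈ (↑(univ.image f) : Set V) := by simp
    have hj : f j ∈ (↑(univ.image f) : Set V) := by simp
    exact h hi hj (G.ne_of_adj hadj) hadj

omit [Fintype V] [DecidableEq V] in
/-- For `A` a set of non-diagonal pairs of `Fin s`, a map `f : Fin s → V` is a homomorphism from the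
graph with edge set `A` to `G` iff every pair in `A` is sent to an edge of `G`. -/
theorem isHom_fromEdgeSet_iff {s : ℕ} (G : SimpleGraph V) (f : Fin s → V)
    {A : Finset (Sym2 (Fin s))} (hA : ∀ e ∈ A, ¬ e.IsDiag) :
    Dvorak2010.IsHom (fromEdgeSet (A : Set (Sym2 (Fin s)))) G f ↔
      ∀ e ∈ A, e ∈ (G.comap f).edgeSet := by
  constructor
  · intro h e he
    have hnd := hA e he
    obtain ⟨a, b⟩ := e
    rw [Sym2.mk_isDiag_iff] at hnd
    rw [mem_edgeSet, comap_adj]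
    exact h ((fromEdgeSet_adj _).2 ⟨he, hnd⟩)
  · intro h a b hab
    rw [fromEdgeSet_adj, mem_coe] at hab
    have := h _ hab.1
    rwa [mem_edgeSet, comap_adj] at this

omit [DecidableEq V] in
/-- **Inclusion–exclusion over the edge sets of `K_s`.** The number of maps `f : Fin s → V` sending
no pair to an edge of `G` is `∑_{A ⊆ E(K_s)} (-1)^{|A|} · |Hom((Fin s, A), G)|`, the sum running over
the sets `A` of non-diagonal unordered pairs. -/
theorem natCard_indepMaps_eq_sum (G : SimpleGraph V) (s : ℕ) :
    (Nat.card {f : Fin s → V // ∀ i j, ¬ G.Adj (f i) (f j)} : ℤ) =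
      ∑ A ∈ (univ.filter fun e : Sym2 (Fin s) => ¬ e.IsDiag).powerset,
        (-1 : ℤ) ^ A.card * (Nat.card (fromEdgeSet (A : Set (Sym2 (Fin s))) →g G) : ℤ) := by
  classical
  set E₀ : Finset (Sym2 (Fin s)) := univ.filter fun e : Sym2 (Fin s) => ¬ e.IsDiag with hE₀
  -- the pairs that `f` maps onto edges
  set Ef : (Fin s → V) → Finset (Sym2 (Fin s)) :=
    fun f => E₀.filter fun e => e ∈ (G.comap f).edgeSet with hEf
  have hEfE₀ : ∀ f, Ef f ⊆ E₀ := fun f => filter_subset _ _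
  -- hom counts as sums of indicators
  have hhom : ∀ A ∈ E₀.powerset, (Nat.card (fromEdgeSet (A : Set (Sym2 (Fin s))) →g G) : ℤ) =
      ∑ f : Fin s → V, if A ⊆ Ef f then (1 : ℤ) else 0 := by
    intro A hA
    have hA' : ∀ e ∈ A, ¬ e.IsDiag := fun e he =>
      (mem_filter.1 (mem_powerset.1 hA he)).2
    rw [Dvorak2010.card_hom_eq_card_subtype,
      Nat.subtype_card (univ.filter fun f : Fin s → V =>
        Dvorak2010.IsHom (fromEdgeSet (A : Set (Sym2 (Fin s)))) G f) (fun f => by simp),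
      natCast_card_filter]
    refine sum_congr rfl fun f _ => if_congr ?_ rfl rfl
    rw [isHom_fromEdgeSet_iff G f hA']
    constructor
    · intro h e he
      exact mem_filter.2 ⟨mem_powerset.1 hA he, h e he⟩
    · intro h e he
      exact (mem_filter.1 (h he)).2
  -- the left-hand side as a sum of indicators
  have hlhs : (Nat.card {f : Fin s → V // ∀ i j, ¬ G.Adj (f i) (f j)} : ℤ) =
      ∑ f : Fin s → V, if (∀ i j, ¬ G.Adj (f i) (f j)) then (1 : ℤ) else 0 := by
    rw [Nat.subtype_card (univ.filter fun f : Fin s → V => ∀ i j, ¬ G.Adj (f i) (f j))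
      (fun f => by simp), natCast_card_filter]
  -- `Ef f = ∅` iff `f` maps no pair to an edge
  have hempty : ∀ f : Fin s → V, Ef f = ∅ ↔ ∀ i j, ¬ G.Adj (f i) (f j) := by
    intro f
    constructor
    · intro h i j hadj
      have hij : i ≠ j := fun hij => G.ne_of_adj hadj (by rw [hij])
      have hmem : s(i, j) ∈ Ef f := by
        refine mem_filter.2 ⟨mem_filter.2 ⟨mem_univ _, ?_⟩, ?_⟩
        · rwa [Sym2.mk_isDiag_iff]
        · rwa [mem_edgeSet, comap_adj]
      rw [h] at hmem
      exact notMem_empty _ hmem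
    · intro h
      refine eq_empty_iff_forall_notMem.2 fun e he => ?_
      have he' := (mem_filter.1 he).2
      obtain ⟨a, b⟩ := e
      rw [mem_edgeSet, comap_adj] at he'
      exact h a b he'
  have hrhs : ∑ A ∈ E₀.powerset,
        (-1 : ℤ) ^ A.card * (Nat.card (fromEdgeSet (A : Set (Sym2 (Fin s))) →g G) : ℤ) =
      ∑ A ∈ E₀.powerset, ∑ f : Fin s → V, (-1 : ℤ) ^ A.card * (if A ⊆ Ef f then (1 : ℤ) else 0) :=
    sum_congr rfl fun A hA => by rw [hhom A hA, mul_sum]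
  rw [hlhs, hrhs, sum_comm]
  refine sum_congr rfl fun f _ => ?_
  -- for fixed `f`: `∑_{A ⊆ E₀} (-1)^{|A|} [A ⊆ Ef f] = ∑_{A ⊆ Ef f} (-1)^{|A|} = [Ef f = ∅]`
  have hfilter : E₀.powerset.filter (fun A => A ⊆ Ef f) = (Ef f).powerset := by
    ext A
    simp only [mem_filter, mem_powerset]
    exact ⟨fun h => h.2, fun h => ⟨h.trans (hEfE₀ f), h⟩⟩
  calc (if (∀ i j, ¬ G.Adj (f i) (f j)) then (1 : ℤ) else 0)
      = if Ef f = ∅ then (1 : ℤ) else 0 := if_congr (hempty f).symm rfl rfl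
    _ = ∑ A ∈ (Ef f).powerset, (-1 : ℤ) ^ A.card := sum_powerset_neg_one_pow_card.symm
    _ = ∑ A ∈ E₀.powerset.filter (fun A => A ⊆ Ef f), (-1 : ℤ) ^ A.card := by rw [hfilter]
    _ = ∑ A ∈ E₀.powerset, if A ⊆ Ef f then (-1 : ℤ) ^ A.card else 0 := sum_filter _ _
    _ = ∑ A ∈ E₀.powerset, (-1 : ℤ) ^ A.card * (if A ⊆ Ef f then (1 : ℤ) else 0) :=
        sum_congr rfl fun A _ => by split_ifs <;> simp

/-- Maps `Fin s → V` with image exactly `I` correspond to surjections onto `Fin |I|`. -/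
theorem card_filter_image_eq (I : Finset V) (s : ℕ) :
    (univ.filter fun f : Fin s → V => univ.image f = I).card =
      Nat.card {g : Fin s → Fin I.card // Function.Surjective g} := by
  rw [show (univ.filter fun f : Fin s → V => univ.image f = I).card =
      Nat.card {f : Fin s → V // univ.image f = I} from
    (Nat.subtype_card (univ.filter fun f : Fin s → V => univ.image f = I) (fun f => by simp)).symm]
  set eI := I.equivFin with heI
  have hmem : ∀ (f : Fin s → V), univ.image f = I → ∀ i, f i ∈ I := fun f hf i => by
    rw [← hf]; exact mem_image_of_mem f (mem_univ i)
  refine Nat.card_congr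
    { toFun := fun f => ⟨fun i => eI ⟨f.1 i, hmem f.1 f.2 i⟩, fun y => ?_⟩
      invFun := fun g => ⟨fun i => ((eI.symm (g.1 i) : I) : V), ?_⟩
      left_inv := fun f => ?_
      right_inv := fun g => ?_ }
  · have hx' : ((eI.symm y : I) : V) ∈ univ.image f.1 := by rw [f.2]; exact (eI.symm y).2
    obtain ⟨i, -, hi⟩ := mem_image.1 hx'
    refine ⟨i, ?_⟩
    change eI ⟨f.1 i, hmem f.1 f.2 i⟩ = y
    rw [show (⟨f.1 i, hmem f.1 f.2 i⟩ : I) = eI.symm y from Subtype.ext hi, Equiv.apply_symm_apply]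
  · ext x
    simp only [mem_image, mem_univ, true_and]
    constructor
    · rintro ⟨i, rfl⟩
      exact (eI.symm (g.1 i)).2
    · intro hx
      obtain ⟨i, hi⟩ := g.2 (eI ⟨x, hx⟩)
      exact ⟨i, by rw [hi, Equiv.symm_apply_apply]⟩
  · apply Subtype.ext
    funext i
    simp
  · apply Subtype.ext
    funext i
    simp

/-- **Sorting by the image.** The number of maps `Fin s → V` sending no pair to an edge of `G` is
`∑_j surj(s, j) · i_j(G)`, where `i_j(G)` is the number of independent `j`-subsets of `G` and
`surj(s, j)` the number of surjections `Fin s → Fin j`. -/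
theorem natCard_indepMaps_eq_sum_surj (G : SimpleGraph V) (s : ℕ) :
    Nat.card {f : Fin s → V // ∀ i j, ¬ G.Adj (f i) (f j)} =
      ∑ j ∈ range (Fintype.card V + 1), Nat.card {g : Fin s → Fin j // Function.Surjective g} *
        Nat.card {I : Finset V // G.IsIndepSet ↑I ∧ I.card = j} := by
  classical
  set T : Finset (Finset V) := univ.filter fun I : Finset V => G.IsIndepSet ↑I with hT
  have h1 : Nat.card {f : Fin s → V // ∀ i j, ¬ G.Adj (f i) (f j)} =
      (univ.filter fun f : Fin s → V => G.IsIndepSet ↑(univ.image f)).card :=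
    Nat.subtype_card _ fun f => by
      simp only [mem_filter, mem_univ, true_and]
      exact (forall_not_adj_iff_isIndepSet_image G f).symm
  have h2 : (univ.filter fun f : Fin s → V => G.IsIndepSet ↑(univ.image f)).card =
      ∑ I ∈ T, (univ.filter fun f : Fin s → V => univ.image f = I).card := by
    rw [card_eq_sum_card_fiberwise (f := fun f : Fin s → V => univ.image f) (t := T)
      (fun f hf => by
        rw [mem_coe, mem_filter] at hf
        exact mem_filter.2 ⟨mem_univ _, hf.2⟩)]
    refine sum_congr rfl fun I hI => ?_
    congr 1
    ext f
    simp only [mem_filter, mem_univ, true_and, and_iff_right_iff_imp]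
    intro hf
    rw [hf]
    exact (mem_filter.1 hI).2
  have h3 : ∑ I ∈ T, (univ.filter fun f : Fin s → V => univ.image f = I).card =
      ∑ I ∈ T, Nat.card {g : Fin s → Fin I.card // Function.Surjective g} :=
    sum_congr rfl fun I _ => card_filter_image_eq I s
  have h4 : ∀ j, Nat.card {I : Finset V // G.IsIndepSet ↑I ∧ I.card = j} =
      (T.filter fun I => I.card = j).card := fun j =>
    Nat.subtype_card _ fun I => by simp [hT]
  rw [h1, h2, h3, ← sum_fiberwise_of_maps_to (s := T) (t := range (Fintype.card V + 1))
    (g := fun I : Finset V => I.card) (fun I _ => mem_range.2 (Nat.lt_succ_of_le I.card_le_univ))]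
  refine sum_congr rfl fun j _ => ?_
  rw [h4 j, sum_congr rfl fun I hI => by rw [(mem_filter.1 hI).2], sum_const, smul_eq_mul, mul_comm]

/-- There is no surjection `Fin s → Fin j` when `s < j`. -/
theorem natCard_surj_eq_zero {s j : ℕ} (h : s < j) :
    Nat.card {g : Fin s → Fin j // Function.Surjective g} = 0 := by
  refine Nat.card_eq_zero.2 (Or.inl ⟨fun g => ?_⟩)
  have := Fintype.card_le_of_surjective g.1 g.2
  simp only [Fintype.card_fin] at this
  omega

/-- The identity is a surjection `Fin s → Fin s`, so `surj(s, s) ≠ 0`. -/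
theorem natCard_surj_self_ne_zero (s : ℕ) :
    Nat.card {g : Fin s → Fin s // Function.Surjective g} ≠ 0 :=
  Nat.card_ne_zero.2 ⟨⟨⟨id, Function.surjective_id⟩⟩, inferInstance⟩

omit [DecidableEq V] in
/-- Beyond `|V|` there are no independent sets. -/
theorem natCard_indepSets_eq_zero_of_lt (G : SimpleGraph V) {j : ℕ} (h : Fintype.card V < j) :
    Nat.card {I : Finset V // G.IsIndepSet ↑I ∧ I.card = j} = 0 := by
  refine Nat.card_eq_zero.2 (Or.inl ⟨fun I => ?_⟩)
  have := I.1.card_le_univ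
  have := I.2.2
  omega

/-- **The triangular system solved.** If the numbers of maps `Fin s → V` with edge-free image agree
for `G` and `H` for all `s ≤ m`, then `G` and `H` have the same number of independent sets of each
size `j ≤ m`. -/
theorem natCard_indepSets_eq_of_natCard_indepMaps_eq (G H : SimpleGraph V) {m : ℕ}
    (h : ∀ s ≤ m, Nat.card {f : Fin s → V // ∀ i j, ¬ G.Adj (f i) (f j)} =
      Nat.card {f : Fin s → V // ∀ i j, ¬ H.Adj (f i) (f j)})
    {j : ℕ} (hj : j ≤ m) :
    Nat.card {I : Finset V // G.IsIndepSet ↑I ∧ I.card = j} =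
      Nat.card {I : Finset V // H.IsIndepSet ↑I ∧ I.card = j} := by
  induction j using Nat.strong_induction_on with
  | _ j ih =>
    have hs := h j hj
    rw [natCard_indepMaps_eq_sum_surj, natCard_indepMaps_eq_sum_surj] at hs
    -- termwise equality off the diagonal term `i = j`
    have hoff : ∀ i ∈ (range (Fintype.card V + 1)).erase j,
        Nat.card {g : Fin j → Fin i // Function.Surjective g} *
            Nat.card {I : Finset V // G.IsIndepSet ↑I ∧ I.card = i} =
          Nat.card {g : Fin j → Fin i // Function.Surjective g} *
            Nat.card {I : Finset V // H.IsIndepSet ↑I ∧ I.card = i} := by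
      intro i hi
      rcases lt_or_gt_of_ne (mem_erase.1 hi).1 with hlt | hgt
      · rw [ih i hlt (by omega)]
      · rw [natCard_surj_eq_zero hgt, zero_mul, zero_mul]
    by_cases hjV : j ∈ range (Fintype.card V + 1)
    · rw [← sum_erase_add _ _ hjV, ← sum_erase_add _ _ hjV, sum_congr rfl hoff] at hs
      exact Nat.eq_of_mul_eq_mul_left (Nat.pos_of_ne_zero (natCard_surj_self_ne_zero j))
        (Nat.add_left_cancel hs)
    · have hlt : Fintype.card V < j := by rw [mem_range] at hjV; omega
      rw [natCard_indepSets_eq_zero_of_lt G hlt, natCard_indepSets_eq_zero_of_lt H hlt]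

/-- **Homomorphism counts of graphs on at most `m` vertices determine the numbers of independent
sets of each size `j ≤ m`.** (Both are instances of Lovász's principle that hom counts of small
graphs determine injective and induced counts; here only the edgeless induced counts are needed.) -/
theorem natCard_indepSets_eq_of_homCount_eq (G H : SimpleGraph V) {m : ℕ}
    (hhom : ∀ s ≤ m, ∀ F : SimpleGraph (Fin s), Nat.card (F →g G) = Nat.card (F →g H))
    {j : ℕ} (hj : j ≤ m) :
    Nat.card {I : Finset V // G.IsIndepSet ↑I ∧ I.card = j} =
      Nat.card {I : Finset V // H.IsIndepSet ↑I ∧ I.card = j} := by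
  refine natCard_indepSets_eq_of_natCard_indepMaps_eq G H (fun s hs => ?_) hj
  have key : (Nat.card {f : Fin s → V // ∀ i j, ¬ G.Adj (f i) (f j)} : ℤ) =
      Nat.card {f : Fin s → V // ∀ i j, ¬ H.Adj (f i) (f j)} := by
    rw [natCard_indepMaps_eq_sum, natCard_indepMaps_eq_sum]
    exact sum_congr rfl fun A _ => by rw [hhom s hs]
  exact_mod_cast key

end Summit.PneNP.PneNP.Theorems.DensityContinuityBelow
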